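import Mathlib.LinearAlgebra.Matrix.GeneralLinearGroup.Defs
import Mathlib.LinearAlgebra.Matrix.NonsingularInverse
import Mathlib.RingTheory.Ideal.Maps
import Mathlib.Tactic.NoncommRing
import Mathlib.Tactic.Group
import HarnessLib

/-!
# The obstruction to lifting a representation through a square-zero extension (Mazur)

Topic `Literature/NumberTheory/GaloisRepresentations`.  Let `φ : B ↠ A` be a surjection of
commutative rings whose kernel `I` has `I² = 0`, and `ρ : G → GL_n(A)` a homomorphism.  The
kernel of `GL_n(B) → GL_n(A)` is `1 + M_n(I)`, an ABELIAN group isomorphic to the additive group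
`M_n(I)` of matrices with entries in `I` (`(1 + X)(1 + Y) = 1 + X + Y` as `XY = 0`), on which
`G` acts by conjugation through `ρ` (conjugation by any lift of `ρ(σ)`; lifts differ by elements
of `1 + M_n(I)`, which act trivially).  Choosing a set-theoretic lift `s : GL_n(A) → GL_n(B)`
(it exists: `GL_n(B) → GL_n(A)` is onto, units lifting through a nil extension), the defect
`c(σ, τ) = s(ρσ) s(ρτ) s(ρ(στ))⁻¹ − 1 ∈ M_n(I)` is a `2`-cocycle for this action, and **`ρ` lifts
to a homomorphism `G → GL_n(B)` iff `c` is a coboundary** `c(σ, τ) = σ·b(τ) − b(στ) + b(σ)`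
(the lifts being `σ ↦ (1 − b(σ)) s(ρσ)`): this is the obstruction class
`o(ρ) ∈ H²(G, ad ρ ⊗ I)` of B. Mazur, *Deforming Galois representations* (1989), §1.6 (proof of
Prop. 2; "the obstruction to lifting … lies in `H²(Π, ad ρ̄) ⊗ I`"), behind the canonical
surjection `H²(Π, ad ρ̄)^* ↠ J/𝔪J` of G. Böckle, *Presentations of universal deformation rings*
(2007), (1).  This file PROVES the algebraic (cochain-level) statement for an abstract group `G`;
the topological refinement (continuous cochains for a profinite `G` and finite `A`, `B`) only adds
that all maps in sight are locally constant.

* `kerMatrix φ` — the additive group `M_n(I)` of matrices killed by `φ`; `kerMatrix_mul_kerMatrix`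
  (`XY = 0`), `conj_eq_of_map_eq` (lifts of the same element of `GL_n(A)` conjugate `M_n(I)`
  identically);
* `isUnit_of_isUnit_map`, `generalLinearGroup_map_surjective` — units and invertible matrices lift
  through a square-zero (nil) extension;
* `liftDefect s ρ σ τ = s(ρσ) s(ρτ) s(ρ(στ))⁻¹ − 1 ∈ M_n(I)` and its `2`-cocycle identity
  `liftDefect_cocycle`;
* `liftOfCoboundary` (the lift `σ ↦ (1 − b(σ)) s(ρσ)` attached to a splitting cochain `b`),
  `liftDefect_eq_of_lift` (the splitting cochain `b(σ) = 1 − ρ'(σ) s(ρσ)⁻¹` attached to a lift),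
  `exists_lift_iff_exists_coboundary` — **Mazur's obstruction criterion**.

## References

* B. Mazur, *Deforming Galois representations*, in Galois groups over `ℚ`, MSRI Publ. 16
  (1989), §1.6 (Prop. 2 and its proof). [cite: Mazur1989Deforming, §1.6 Prop. 2]
* G. Böckle, *Presentations of universal deformation rings*, LMS LNS 320 (2007), Thm. 2.2 and
  (1). [cite: Bockle2007Presentations, Theorem 2.2]
-/

noncomputable section

namespace Literature.NumberTheory.GaloisRepresentations

namespace LiftingObstruction

open Matrix

variable {n : Type*} [Fintype n] [DecidableEq n] {A B : Type*} [CommRing A] [CommRing B]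
  (φ : B →+* A)

/-! ## 1. The kernel matrices `M_n(I)` -/

/-- `M_n(I)`: the matrices over `B` killed entrywise by `φ : B → A` (`I = ker φ`), i.e. the kernel
of `M_n(φ)`; for `I² = 0` this is the (abelian) kernel `1 + M_n(I)` of `GL_n(B) → GL_n(A)` written
additively. [cite: Mazur1989Deforming, §1.6 Prop. 2] -/
def kerMatrix : AddSubgroup (Matrix n n B) :=
  (φ.mapMatrix : Matrix n n B →+* Matrix n n A).toAddMonoidHom.ker

variable {φ}

/-- Membership in `M_n(I)`: every entry lies in `ker φ`. [folklore] -/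
theorem mem_kerMatrix_iff (X : Matrix n n B) : X ∈ kerMatrix φ ↔ ∀ i j, φ (X i j) = 0 := by
  change φ.mapMatrix X = 0 ↔ _
  rw [← Matrix.ext_iff]
  rfl

/-- Membership in `M_n(I)` as the vanishing of `M_n(φ)`. [folklore] -/
theorem mem_kerMatrix_iff_map (X : Matrix n n B) : X ∈ kerMatrix φ ↔ φ.mapMatrix X = 0 :=
  Iff.rfl

/-- `M_n(I)` is a two-sided ideal: stable under left multiplication. [folklore] -/
theorem mul_mem_kerMatrix_left (P : Matrix n n B) {X : Matrix n n B} (hX : X ∈ kerMatrix φ) :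
    P * X ∈ kerMatrix φ := by
  rw [mem_kerMatrix_iff_map] at hX ⊢
  rw [map_mul, hX, mul_zero]

/-- `M_n(I)` is a two-sided ideal: stable under right multiplication. [folklore] -/
theorem mul_mem_kerMatrix_right (P : Matrix n n B) {X : Matrix n n B} (hX : X ∈ kerMatrix φ) :
    X * P ∈ kerMatrix φ := by
  rw [mem_kerMatrix_iff_map] at hX ⊢
  rw [map_mul, hX, zero_mul]

section SquareZero

variable (hI : ∀ x ∈ RingHom.ker φ, ∀ y ∈ RingHom.ker φ, x * y = 0)
include hI

/-- **`M_n(I) · M_n(I) = 0`** when `I² = 0`. [cite: Mazur1989Deforming, §1.6 Prop. 2] -/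
theorem kerMatrix_mul_kerMatrix {X Y : Matrix n n B} (hX : X ∈ kerMatrix φ)
    (hY : Y ∈ kerMatrix φ) : X * Y = 0 := by
  rw [mem_kerMatrix_iff] at hX hY
  ext i j
  rw [Matrix.mul_apply, Matrix.zero_apply]
  exact Finset.sum_eq_zero fun k _ => hI _ (hX i k) _ (hY k j)

/-- `(1 + X)(1 - X) = 1` for `X ∈ M_n(I)`. [folklore] -/
theorem one_add_mul_one_sub {X : Matrix n n B} (hX : X ∈ kerMatrix φ) : (1 + X) * (1 - X) = 1 := by
  rw [add_mul, mul_sub, mul_sub, one_mul, mul_one, one_mul, kerMatrix_mul_kerMatrix hI hX hX]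
  abel

/-- **Units lift through a square-zero extension**: if `φ(x)` is a unit then so is `x`
(`x y = 1 + i` with `i ∈ I`, and `1 + i` is a unit). [folklore] -/
theorem isUnit_of_isUnit_map (hφ : Function.Surjective φ) {x : B} (hx : IsUnit (φ x)) :
    IsUnit x := by
  obtain ⟨a, ha⟩ := hx.exists_right_inv
  obtain ⟨y, rfl⟩ := hφ a
  have hi : x * y - 1 ∈ RingHom.ker φ := by
    rw [RingHom.mem_ker, map_sub, map_mul, map_one, ha, sub_self]
  have h1 : (x * y) * (1 - (x * y - 1)) = 1 := by
    have e : (x * y) * (1 - (x * y - 1)) = 1 - (x * y - 1) * (x * y - 1) := by ring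
    rw [e, hI _ hi _ hi, sub_zero]
  rw [mul_assoc] at h1
  exact IsUnit.of_mul_eq_one _ h1

omit hI in
/-- An element of `GL_n(B)` mapping to `1` in `GL_n(A)` is `1 + X` with `X ∈ M_n(I)`. [folklore] -/
theorem val_sub_one_mem (D : GL n B) (hD : Matrix.GeneralLinearGroup.map φ D = 1) :
    (D : Matrix n n B) - 1 ∈ kerMatrix φ := by
  rw [mem_kerMatrix_iff_map, map_sub, map_one, sub_eq_zero]
  have h := congrArg (fun g : GL n A => (g : Matrix n n A)) hD
  simpa [Matrix.GeneralLinearGroup.map] using h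

omit hI in
/-- … and then its inverse is `1 - X`. [folklore] -/
theorem val_inv_eq_of_map_eq_one (hI : ∀ x ∈ RingHom.ker φ, ∀ y ∈ RingHom.ker φ, x * y = 0)
    (D : GL n B) (hD : Matrix.GeneralLinearGroup.map φ D = 1) :
    ((D⁻¹ : GL n B) : Matrix n n B) = 1 - ((D : Matrix n n B) - 1) := by
  have hX := val_sub_one_mem D hD
  have h1 : (D : Matrix n n B) * (1 - ((D : Matrix n n B) - 1)) = 1 := by
    have e : (D : Matrix n n B) = 1 + ((D : Matrix n n B) - 1) := by abel
    conv_lhs => rw [e]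
    rw [add_sub_cancel_left]
    exact one_add_mul_one_sub hI hX
  calc ((D⁻¹ : GL n B) : Matrix n n B)
      = ((D⁻¹ : GL n B) : Matrix n n B) * ((D : Matrix n n B) * (1 - ((D : Matrix n n B) - 1))) := by
        rw [h1, mul_one]
    _ = 1 - ((D : Matrix n n B) - 1) := by
        rw [← mul_assoc, ← Units.val_mul, inv_mul_cancel, Units.val_one, one_mul]

/-- **Elements of `1 + M_n(I)` act trivially on `M_n(I)` by conjugation.** [cite: Mazur1989Deforming, §1.6 Prop. 2] -/
theorem conj_eq_self_of_map_eq_one (D : GL n B) (hD : Matrix.GeneralLinearGroup.map φ D = 1)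
    {X : Matrix n n B} (hX : X ∈ kerMatrix φ) :
    (D : Matrix n n B) * X * ((D⁻¹ : GL n B) : Matrix n n B) = X := by
  have hY := val_sub_one_mem D hD
  have hinv := val_inv_eq_of_map_eq_one hI D hD
  set Y := (D : Matrix n n B) - 1 with hYdef
  have eD : (D : Matrix n n B) = 1 + Y := by rw [hYdef]; abel
  rw [hinv, eD]
  have e : (1 + Y) * X * (1 - Y) = X + Y * X - X * Y - Y * X * Y := by noncomm_ring
  rw [e, kerMatrix_mul_kerMatrix hI hY hX, kerMatrix_mul_kerMatrix hI hX hY, zero_mul]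
  abel

/-- **Conjugation on `M_n(I)` depends only on the image in `GL_n(A)`**: two lifts of the same
element conjugate `M_n(I)` identically. [cite: Mazur1989Deforming, §1.6 Prop. 2] -/
theorem conj_eq_of_map_eq (P Q : GL n B)
    (hPQ : Matrix.GeneralLinearGroup.map φ P = Matrix.GeneralLinearGroup.map φ Q)
    {X : Matrix n n B} (hX : X ∈ kerMatrix φ) :
    (P : Matrix n n B) * X * ((P⁻¹ : GL n B) : Matrix n n B) =
      (Q : Matrix n n B) * X * ((Q⁻¹ : GL n B) : Matrix n n B) := by
  -- `Q = P D` with `D ↦ 1`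
  set D : GL n B := P⁻¹ * Q with hDdef
  have hD : Matrix.GeneralLinearGroup.map φ D = 1 := by
    rw [hDdef, map_mul, map_inv, hPQ, inv_mul_cancel]
  have hQ : Q = P * D := by rw [hDdef]; group
  clear_value D
  have hQi : Q⁻¹ = D⁻¹ * P⁻¹ := by rw [hQ, _root_.mul_inv_rev]
  have h1 := conj_eq_self_of_map_eq_one hI D hD hX
  rw [hQi, hQ, Units.val_mul, Units.val_mul]
  rw [show (P : Matrix n n B) * (D : Matrix n n B) * X *
      (((D⁻¹ : GL n B) : Matrix n n B) * ((P⁻¹ : GL n B) : Matrix n n B)) =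
      (P : Matrix n n B) * ((D : Matrix n n B) * X * ((D⁻¹ : GL n B) : Matrix n n B)) *
        ((P⁻¹ : GL n B) : Matrix n n B) by noncomm_ring, h1]

/-- `δ(D₁ D₂) = δ(D₁) + δ(D₂)` on `1 + M_n(I)`, where `δ(D) = D − 1`: the kernel is abelian and
`D ↦ D − 1` is an isomorphism onto `M_n(I)`. [cite: Mazur1989Deforming, §1.6 Prop. 2] -/
theorem val_mul_sub_one (D₁ D₂ : GL n B) (h₁ : Matrix.GeneralLinearGroup.map φ D₁ = 1)
    (h₂ : Matrix.GeneralLinearGroup.map φ D₂ = 1) :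
    ((D₁ * D₂ : GL n B) : Matrix n n B) - 1 =
      ((D₁ : Matrix n n B) - 1) + ((D₂ : Matrix n n B) - 1) := by
  have e : ((D₁ * D₂ : GL n B) : Matrix n n B) - 1 = ((D₁ : Matrix n n B) - 1) +
      ((D₂ : Matrix n n B) - 1) + ((D₁ : Matrix n n B) - 1) * ((D₂ : Matrix n n B) - 1) := by
    rw [Units.val_mul]
    noncomm_ring
  rw [e, kerMatrix_mul_kerMatrix hI (val_sub_one_mem D₁ h₁) (val_sub_one_mem D₂ h₂),
    add_zero]

/-! ## 2. Set-theoretic lifts -/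

/-- **`GL_n(B) → GL_n(A)` is onto** for a surjection with square-zero kernel (lift the entries;
the determinant is a unit because its image is). [folklore] -/
theorem generalLinearGroup_map_surjective (hφ : Function.Surjective φ) :
    Function.Surjective (Matrix.GeneralLinearGroup.map (n := n) φ) := by
  intro g
  let M : Matrix n n B := (g : Matrix n n A).map (Function.surjInv hφ)
  have hM : φ.mapMatrix M = (g : Matrix n n A) := by
    ext i j
    simp [M, Function.surjInv_eq hφ]
  have hdet : IsUnit M.det := by
    refine isUnit_of_isUnit_map hI hφ ?_
    rw [RingHom.map_det, hM]
    exact (Matrix.isUnit_iff_isUnit_det _).mp (Units.isUnit g)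
  have hMu : IsUnit M := (Matrix.isUnit_iff_isUnit_det M).mpr hdet
  refine ⟨hMu.unit, Units.ext ?_⟩
  simp [Matrix.GeneralLinearGroup.map, hM]

end SquareZero

/-! ## 3. The lifting defect and its cocycle identity -/

variable {G : Type*} [Group G]

/-- The **lifting defect** of `ρ : G → GL_n(A)` with respect to a set-theoretic lift
`s : GL_n(A) → GL_n(B)` of `φ`: the element `s(ρσ) s(ρτ) s(ρ(στ))⁻¹` of the kernel of
`GL_n(B) → GL_n(A)`. [cite: Mazur1989Deforming, §1.6 Prop. 2] -/
def defectUnit (s : GL n A → GL n B) (ρ : G →* GL n A) (σ τ : G) : GL n B :=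
  s (ρ σ) * s (ρ τ) * (s (ρ (σ * τ)))⁻¹

/-- The lifting defect written additively, `c(σ, τ) = s(ρσ) s(ρτ) s(ρ(στ))⁻¹ − 1 ∈ M_n(I)` — the
inhomogeneous `2`-cocycle representing Mazur's obstruction class.
[cite: Mazur1989Deforming, §1.6 Prop. 2] -/
def liftDefect (s : GL n A → GL n B) (ρ : G →* GL n A) (σ τ : G) : Matrix n n B :=
  (defectUnit s ρ σ τ : Matrix n n B) - 1

variable {s : GL n A → GL n B} (hs : ∀ g, Matrix.GeneralLinearGroup.map φ (s g) = g)
include hs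

/-- The defect maps to `1` in `GL_n(A)`. [folklore] -/
theorem map_defectUnit (ρ : G →* GL n A) (σ τ : G) :
    Matrix.GeneralLinearGroup.map φ (defectUnit s ρ σ τ) = 1 := by
  rw [defectUnit, map_mul, map_mul, map_inv, hs, hs, hs, ← _root_.map_mul, mul_inv_cancel]

/-- `c(σ, τ) ∈ M_n(I)`. [cite: Mazur1989Deforming, §1.6 Prop. 2] -/
theorem liftDefect_mem (ρ : G →* GL n A) (σ τ : G) : liftDefect s ρ σ τ ∈ kerMatrix φ :=
  val_sub_one_mem _ (map_defectUnit hs ρ σ τ)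

omit hs in
/-- The multiplicative `2`-cocycle identity of the defect (valid for any section, in any group):
`γ(σ,τ) γ(στ,υ) = s(ρσ) γ(τ,υ) s(ρσ)⁻¹ γ(σ,τυ)`. [folklore] -/
theorem defectUnit_mul_defectUnit (ρ : G →* GL n A) (σ τ υ : G) :
    defectUnit s ρ σ τ * defectUnit s ρ (σ * τ) υ =
      s (ρ σ) * defectUnit s ρ τ υ * (s (ρ σ))⁻¹ * defectUnit s ρ σ (τ * υ) := by
  simp only [defectUnit, mul_assoc, map_mul]
  group

/-- **The `2`-cocycle identity** for `c = liftDefect s ρ` with `G` acting on `M_n(I)` by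
conjugation through `s ∘ ρ`: `σ·c(τ, υ) + c(σ, τυ) = c(στ, υ) + c(σ, τ)` (the tree's convention
`mem_contTwoCocycles_iff`). [cite: Mazur1989Deforming, §1.6 Prop. 2] -/
theorem liftDefect_cocycle (hI : ∀ x ∈ RingHom.ker φ, ∀ y ∈ RingHom.ker φ, x * y = 0)
    (ρ : G →* GL n A) (σ τ υ : G) :
    (s (ρ σ) : Matrix n n B) * liftDefect s ρ τ υ * ((s (ρ σ))⁻¹ : GL n B) +
        liftDefect s ρ σ (τ * υ) =
      liftDefect s ρ (σ * τ) υ + liftDefect s ρ σ τ := by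
  have hconj : Matrix.GeneralLinearGroup.map φ (s (ρ σ) * defectUnit s ρ τ υ * (s (ρ σ))⁻¹) = 1 := by
    rw [map_mul, map_mul, map_defectUnit hs, mul_one, map_inv, mul_inv_cancel]
  have h : ((defectUnit s ρ σ τ * defectUnit s ρ (σ * τ) υ : GL n B) : Matrix n n B) - 1 =
      ((s (ρ σ) * defectUnit s ρ τ υ * (s (ρ σ))⁻¹ * defectUnit s ρ σ (τ * υ) : GL n B) :
        Matrix n n B) - 1 :=
    congrArg (fun D : GL n B => (D : Matrix n n B) - 1) (defectUnit_mul_defectUnit (s := s) ρ σ τ υ)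
  rw [val_mul_sub_one hI _ _ (map_defectUnit hs ρ σ τ) (map_defectUnit hs ρ (σ * τ) υ),
    val_mul_sub_one hI _ _ hconj (map_defectUnit hs ρ σ (τ * υ))] at h
  have hss : (s (ρ σ) : Matrix n n B) * ((s (ρ σ))⁻¹ : GL n B) = 1 := by
    rw [← Units.val_mul, mul_inv_cancel, Units.val_one]
  have hc : ((s (ρ σ) * defectUnit s ρ τ υ * (s (ρ σ))⁻¹ : GL n B) : Matrix n n B) - 1 =
      (s (ρ σ) : Matrix n n B) * liftDefect s ρ τ υ * ((s (ρ σ))⁻¹ : GL n B) := by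
    rw [Units.val_mul, Units.val_mul, liftDefect, mul_sub, sub_mul, mul_one, hss]
  rw [hc] at h
  change liftDefect s ρ σ τ + liftDefect s ρ (σ * τ) υ =
    (s (ρ σ) : Matrix n n B) * liftDefect s ρ τ υ * ((s (ρ σ))⁻¹ : GL n B) +
      liftDefect s ρ σ (τ * υ) at h
  rw [← h, add_comm]

/-! ## 4. Mazur's criterion: lifts ↔ coboundaries -/

omit hs in
/-- The unit `1 + X` of `GL_n(B)` attached to `X ∈ M_n(I)` (inverse `1 − X`). [folklore] -/
def unitOfKer (hI : ∀ x ∈ RingHom.ker φ, ∀ y ∈ RingHom.ker φ, x * y = 0) (X : Matrix n n B)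
    (hX : X ∈ kerMatrix φ) : GL n B :=
  ⟨1 + X, 1 - X, one_add_mul_one_sub hI hX, by
    have h := one_add_mul_one_sub hI (neg_mem hX)
    rwa [← sub_eq_add_neg, sub_neg_eq_add] at h⟩

omit hs in
/-- `unitOfKer X` has underlying matrix `1 + X`. [folklore] -/
@[simp] theorem val_unitOfKer (hI : ∀ x ∈ RingHom.ker φ, ∀ y ∈ RingHom.ker φ, x * y = 0)
    (X : Matrix n n B) (hX : X ∈ kerMatrix φ) : (unitOfKer hI X hX : Matrix n n B) = 1 + X :=
  rfl

omit hs in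
/-- `unitOfKer X ↦ 1` in `GL_n(A)`. [folklore] -/
theorem map_unitOfKer (hI : ∀ x ∈ RingHom.ker φ, ∀ y ∈ RingHom.ker φ, x * y = 0)
    (X : Matrix n n B) (hX : X ∈ kerMatrix φ) :
    Matrix.GeneralLinearGroup.map φ (unitOfKer hI X hX) = 1 := by
  refine Units.ext ?_
  rw [mem_kerMatrix_iff_map] at hX
  simp [Matrix.GeneralLinearGroup.map, map_add, hX]

omit hs in
/-- Conjugates of kernel elements by `s(ρσ)` map to `1`. [folklore] -/
theorem map_conj_eq_one (ρ : G →* GL n A) (σ : G) (D : GL n B)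
    (hD : Matrix.GeneralLinearGroup.map φ D = 1) :
    Matrix.GeneralLinearGroup.map φ (s (ρ σ) * D * (s (ρ σ))⁻¹) = 1 := by
  rw [map_mul, map_mul, hD, mul_one, map_inv, mul_inv_cancel]

omit hs in
/-- `δ(s D s⁻¹) = s δ(D) s⁻¹`. [folklore] -/
theorem val_conj_sub_one (ρ : G →* GL n A) (σ : G) (D : GL n B) :
    ((s (ρ σ) * D * (s (ρ σ))⁻¹ : GL n B) : Matrix n n B) - 1 =
      (s (ρ σ) : Matrix n n B) * ((D : Matrix n n B) - 1) * ((s (ρ σ))⁻¹ : GL n B) := by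
  have hss : (s (ρ σ) : Matrix n n B) * ((s (ρ σ))⁻¹ : GL n B) = 1 := by
    rw [← Units.val_mul, mul_inv_cancel, Units.val_one]
  rw [Units.val_mul, Units.val_mul, mul_sub, sub_mul, mul_one, hss]

/-- **The lift attached to a coboundary**: if `c(σ, τ) = s(ρσ) b(τ) s(ρσ)⁻¹ − b(στ) + b(σ)` with
`b : G → M_n(I)`, then `σ ↦ (1 − b(σ)) s(ρσ)` is a homomorphism `G → GL_n(B)` lifting `ρ`.
[cite: Mazur1989Deforming, §1.6 Prop. 2] -/
def liftOfCoboundary (hI : ∀ x ∈ RingHom.ker φ, ∀ y ∈ RingHom.ker φ, x * y = 0)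
    (ρ : G →* GL n A) (b : G → Matrix n n B) (hb : ∀ σ, b σ ∈ kerMatrix φ)
    (hcob : ∀ σ τ, liftDefect s ρ σ τ =
      (s (ρ σ) : Matrix n n B) * b τ * ((s (ρ σ))⁻¹ : GL n B) - b (σ * τ) + b σ) :
    G →* GL n B :=
  MonoidHom.mk' (fun σ => unitOfKer hI (-b σ) (neg_mem (hb σ)) * s (ρ σ)) fun σ τ => by
    set D : G → GL n B := fun σ => unitOfKer hI (-b σ) (neg_mem (hb σ)) with hDdef
    have hDmap : ∀ σ, Matrix.GeneralLinearGroup.map φ (D σ) = 1 := fun σ => map_unitOfKer hI _ _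
    have hDval : ∀ σ, (D σ : Matrix n n B) - 1 = -b σ := fun σ => by
      simp [D]
    have hmul : D (σ * τ) = D σ * (s (ρ σ) * D τ * (s (ρ σ))⁻¹) * defectUnit s ρ σ τ := by
      -- both sides lie in `1 + M_n(I)`; compare `δ`
      refine Units.ext (sub_left_injective (b := (1 : Matrix n n B)) ?_)
      change (D (σ * τ) : Matrix n n B) - 1 =
        ((D σ * (s (ρ σ) * D τ * (s (ρ σ))⁻¹) * defectUnit s ρ σ τ : GL n B) : Matrix n n B) - 1
      rw [val_mul_sub_one hI _ _ (by rw [map_mul, hDmap, map_conj_eq_one ρ σ _ (hDmap τ), one_mul])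
          (map_defectUnit hs ρ σ τ),
        val_mul_sub_one hI _ _ (hDmap σ) (map_conj_eq_one ρ σ _ (hDmap τ)), val_conj_sub_one,
        hDval, hDval, hDval, ← liftDefect, hcob σ τ]
      noncomm_ring
    change D (σ * τ) * s (ρ (σ * τ)) = D σ * s (ρ σ) * (D τ * s (ρ τ))
    rw [hmul, defectUnit]
    group

/-- The formula for `liftOfCoboundary`. [folklore] -/
theorem liftOfCoboundary_apply (hI : ∀ x ∈ RingHom.ker φ, ∀ y ∈ RingHom.ker φ, x * y = 0)
    (ρ : G →* GL n A) (b : G → Matrix n n B) (hb : ∀ σ, b σ ∈ kerMatrix φ)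
    (hcob : ∀ σ τ, liftDefect s ρ σ τ =
      (s (ρ σ) : Matrix n n B) * b τ * ((s (ρ σ))⁻¹ : GL n B) - b (σ * τ) + b σ) (σ : G) :
    liftOfCoboundary hs hI ρ b hb hcob σ = unitOfKer hI (-b σ) (neg_mem (hb σ)) * s (ρ σ) :=
  rfl

/-- `liftOfCoboundary` lifts `ρ`. [cite: Mazur1989Deforming, §1.6 Prop. 2] -/
theorem map_liftOfCoboundary (hI : ∀ x ∈ RingHom.ker φ, ∀ y ∈ RingHom.ker φ, x * y = 0)
    (ρ : G →* GL n A) (b : G → Matrix n n B) (hb : ∀ σ, b σ ∈ kerMatrix φ)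
    (hcob : ∀ σ τ, liftDefect s ρ σ τ =
      (s (ρ σ) : Matrix n n B) * b τ * ((s (ρ σ))⁻¹ : GL n B) - b (σ * τ) + b σ) (σ : G) :
    Matrix.GeneralLinearGroup.map φ (liftOfCoboundary hs hI ρ b hb hcob σ) = ρ σ := by
  rw [liftOfCoboundary_apply, map_mul, map_unitOfKer, hs, one_mul]

/-- **The cochain attached to a lift**: if `ρ'` lifts `ρ`, then `b(σ) = 1 − ρ'(σ) s(ρσ)⁻¹ ∈ M_n(I)`
splits the defect, `c(σ, τ) = s(ρσ) b(τ) s(ρσ)⁻¹ − b(στ) + b(σ)`. [cite: Mazur1989Deforming, §1.6 Prop. 2] -/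
theorem liftDefect_eq_of_lift (hI : ∀ x ∈ RingHom.ker φ, ∀ y ∈ RingHom.ker φ, x * y = 0)
    (ρ : G →* GL n A) (ρ' : G →* GL n B)
    (hρ' : ∀ σ, Matrix.GeneralLinearGroup.map φ (ρ' σ) = ρ σ) :
    (∀ σ, -(((ρ' σ * (s (ρ σ))⁻¹ : GL n B) : Matrix n n B) - 1) ∈ kerMatrix φ) ∧
      ∀ σ τ, liftDefect s ρ σ τ =
        (s (ρ σ) : Matrix n n B) * -(((ρ' τ * (s (ρ τ))⁻¹ : GL n B) : Matrix n n B) - 1) *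
            ((s (ρ σ))⁻¹ : GL n B) -
          -(((ρ' (σ * τ) * (s (ρ (σ * τ)))⁻¹ : GL n B) : Matrix n n B) - 1) +
          -(((ρ' σ * (s (ρ σ))⁻¹ : GL n B) : Matrix n n B) - 1) := by
  set D : G → GL n B := fun σ => ρ' σ * (s (ρ σ))⁻¹ with hD
  have hDmap : ∀ σ, Matrix.GeneralLinearGroup.map φ (D σ) = 1 := fun σ => by
    rw [hD, map_mul, map_inv, hρ', hs, mul_inv_cancel]
  have hρD : ∀ σ, ρ' σ = D σ * s (ρ σ) := fun σ => by rw [hD, inv_mul_cancel_right]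
  refine ⟨fun σ => neg_mem (val_sub_one_mem _ (hDmap σ)), fun σ τ => ?_⟩
  change liftDefect s ρ σ τ = (s (ρ σ) : Matrix n n B) * -((D τ : Matrix n n B) - 1) *
      ((s (ρ σ))⁻¹ : GL n B) - -((D (σ * τ) : Matrix n n B) - 1) + -((D σ : Matrix n n B) - 1)
  -- `D(στ) = D(σ) · (s D(τ) s⁻¹) · γ(σ, τ)` in `GL_n(B)`
  have hmul : D (σ * τ) = D σ * (s (ρ σ) * D τ * (s (ρ σ))⁻¹) * defectUnit s ρ σ τ := by
    have e : D (σ * τ) * s (ρ (σ * τ)) = D σ * s (ρ σ) * (D τ * s (ρ τ)) := by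
      rw [← hρD, ← hρD, ← hρD, map_mul]
    have e' : D (σ * τ) = D σ * s (ρ σ) * (D τ * s (ρ τ)) * (s (ρ (σ * τ)))⁻¹ := by
      rw [← e, mul_inv_cancel_right]
    rw [e', defectUnit]
    group
  have h : (D (σ * τ) : Matrix n n B) - 1 =
      ((D σ * (s (ρ σ) * D τ * (s (ρ σ))⁻¹) * defectUnit s ρ σ τ : GL n B) : Matrix n n B) - 1 :=
    congrArg (fun E : GL n B => (E : Matrix n n B) - 1) hmul
  rw [val_mul_sub_one hI _ _ (by rw [map_mul, hDmap, map_conj_eq_one ρ σ _ (hDmap τ), one_mul])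
      (map_defectUnit hs ρ σ τ),
    val_mul_sub_one hI _ _ (hDmap σ) (map_conj_eq_one ρ σ _ (hDmap τ)), val_conj_sub_one] at h
  change _ = _ + liftDefect s ρ σ τ at h
  clear_value D
  generalize (D (σ * τ) : Matrix n n B) - 1 = dστ at h ⊢
  generalize (D σ : Matrix n n B) - 1 = dσ at h ⊢
  generalize (D τ : Matrix n n B) - 1 = dτ at h ⊢
  rw [h, mul_neg, neg_mul]
  abel

/-- **Mazur's obstruction criterion** (cochain level).  For `φ : B ↠ A` with square-zero kernel,
`ρ : G → GL_n(A)` and a set-theoretic lift `s` of `φ` on `GL_n`: `ρ` lifts to a homomorphism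
`ρ̃ : G → GL_n(B)` (`φ ∘ ρ̃ = ρ`) iff the defect cocycle is a coboundary,
`c(σ, τ) = s(ρσ) b(τ) s(ρσ)⁻¹ − b(στ) + b(σ)` for some `b : G → M_n(I)`; the lifts are then the
`σ ↦ (1 − b(σ)) s(ρσ)`.  (So the class of `c` in `H²(G, M_n(I)) = H²(G, ad ρ ⊗ I)` is the
obstruction to lifting `ρ`.) [cite: Mazur1989Deforming, §1.6 Prop. 2] [cite: Bockle2007Presentations, Theorem 2.2] -/
theorem exists_lift_iff_exists_coboundary
    (hI : ∀ x ∈ RingHom.ker φ, ∀ y ∈ RingHom.ker φ, x * y = 0) (ρ : G →* GL n A) :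
    (∃ ρ' : G →* GL n B, ∀ σ, Matrix.GeneralLinearGroup.map φ (ρ' σ) = ρ σ) ↔
      ∃ b : G → Matrix n n B, (∀ σ, b σ ∈ kerMatrix φ) ∧
        ∀ σ τ, liftDefect s ρ σ τ =
          (s (ρ σ) : Matrix n n B) * b τ * ((s (ρ σ))⁻¹ : GL n B) - b (σ * τ) + b σ := by
  constructor
  · rintro ⟨ρ', hρ'⟩
    obtain ⟨hb, hcob⟩ := liftDefect_eq_of_lift hs hI ρ ρ' hρ'
    exact ⟨_, hb, hcob⟩
  · rintro ⟨b, hb, hcob⟩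
    exact ⟨liftOfCoboundary hs hI ρ b hb hcob, map_liftOfCoboundary hs hI ρ b hb hcob⟩

end LiftingObstruction

end Literature.NumberTheory.GaloisRepresentations
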